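import Summits.AtomisticToContinuum.BoseEinsteinCondensation.Theorems.BECProbeMassFlowCloudMomentumAtomImpurityEnergyFinite
import HarnessLib

/-!
# The one-stub alternative: `CloudMomentumAtom` from the "∀Φ ∃Ψ" Anderson fidelity alone
# (crux `BECProbeMassFlow.CloudMomentumAtom`, item stmt-AtomisticToContinuum-12310, lead c3)

Helper file for the crux `BECProbeMassFlow.CloudMomentumAtom`, line `registered` (skeleton
`Cruxes/CloudMomentumAtom/Lines/birth.lean`, v7). The registered skeleton closes the crux from
A (∃-pair fidelity) + B (free clustering) + C (pinned clustering); B and C carry, over the whole admissible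
class `IsRepulsiveFiniteRange` (hard shells, exotic `⊤`-sets), the open hard-wall geometry ("Lemma G") and a
library debt. This file records the ALTERNATIVE composition with a single infrared hypothesis and NO
clustering at all: if for every pinned near-minimiser `Φ` there is SOME free near-minimiser `Ψ` (at any
prescribed free slack) with `|⟨Ψ, Φ⟩|² ≥ 1 − ε` — the "∀Φ ∃Ψ" form of the Anderson fidelity,
`FidelityForEach` below, stated inline as a hypothesis — then the crux follows by the LANDED stubs
`stub_freeZeroMomentum` (p143762: free near-minimisers sit at zero total momentum at fixed `(N, L)`),
`stub_projectionTransfer` (p144993: `w₀(Φ) ≥ (|⟨Ψ,Φ⟩| − (1 − w₀(Ψ))^{1/2})₊²`) and `stub_impurityEnergyFinite`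
(p147259: `E_imp < ⊤` eventually at small density). The "∀Φ ∃Ψ" form is implied by A + B + C
(`andersonFidelityOfFinite_of_clustering`, p150972, gives even "∀Φ ∀Ψ") and carries the same infrared
content as A; it is the shape in which the planner can promote the open stub to an item WITHOUT dragging
B2b/C2a/C2b along (`cloudMomentumAtom_of_fidelityForEach`).
-/

noncomputable section

namespace Summit.AtomisticToContinuum.BoseEinsteinCondensation.Cruxes.CloudMomentumAtom.Birth

open MeasureTheory Filter
open scoped ENNReal NNReal BigOperators ComplexConjugate
open Literature.MathematicalPhysics.QuantumManyBody.BoseGas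

/-- **`CloudMomentumAtom` from the "∀Φ ∃Ψ" Anderson fidelity (one-stub composition, sorry-free).**
Hypothesis (the would-be promoted item, inline): for every repulsive finite-range `v` and `ε > 0` there
is `ρ₀ > 0` such that for `0 < ρ < ρ₀`, eventually in `N`, on the torus of side `L = sideLength ρ (N+1)`
with finite free and pinned infima, for every free slack `δ₂ > 0` there is a pinned slack `δ₁ > 0` such
that EVERY pinned `δ₁`-near-minimiser `Φ` has SOME free `δ₂`-near-minimiser `Ψ` with
`1 − ε ≤ |⟨Ψ, Φ⟩|²`. Conclusion: the crux, by name. Proof: `ε/2` in the hypothesis, `ε²/16` in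
`stub_freeZeroMomentum` (which supplies `δ₂` after `N`), `ρ₀ := min` of the three radii (the third from
`stub_impurityEnergyFinite`, giving `E^per ≤ E_imp < ⊤`), intersect the eventual-`N` sets, take the `δ₁`
of the hypothesis at that `δ₂`, and close with `stub_projectionTransfer`. [folklore] -/
theorem cloudMomentumAtom_of_fidelityForEach
    (hA : ∀ (v : ℝ → ℝ≥0∞), IsRepulsiveFiniteRange v → ∀ ε : ℝ, 0 < ε →
      ∃ ρ₀ : ℝ, 0 < ρ₀ ∧ ∀ ρ : ℝ, 0 < ρ → ρ < ρ₀ → ∀ᶠ N : ℕ in atTop,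
        ∀ L : ℝ, L = sideLength ρ (N + 1) →
          periodicGroundStateEnergy v N L ≠ ⊤ →
          impurityPeriodicGroundStateEnergy v N L 0 ≠ ⊤ →
          ∀ δ₂ : ℝ≥0∞, 0 < δ₂ → ∃ δ₁ : ℝ≥0∞, 0 < δ₁ ∧
            ∀ Φ : PeriodicTrialState N L,
              impurityPeriodicEnergy v 0 Φ ≤ impurityPeriodicGroundStateEnergy v N L 0 + δ₁ →
              ∃ Ψ : PeriodicTrialState N L,
                periodicEnergy v Ψ ≤ periodicGroundStateEnergy v N L + δ₂ ∧
                ENNReal.ofReal (1 - ε) ≤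
                  (‖∫ X in cellN N L, conj (Ψ.ψ X) * Φ.ψ X‖₊ : ℝ≥0∞) ^ 2) :
    Summit.AtomisticToContinuum.BoseEinsteinCondensation.Theses.BECProbeMassFlow.CloudMomentumAtom := by
  intro v hv ε hε
  obtain ⟨ρ₁, hρ₁, H1⟩ := hA v hv (ε / 2) (half_pos hε)
  obtain ⟨ρ₂, hρ₂, H2⟩ := stub_freeZeroMomentum v hv (ε ^ 2 / 16) (by positivity)
  obtain ⟨ρ₃, hρ₃, H3⟩ := stub_impurityEnergyFinite v hv
  refine ⟨min ρ₁ (min ρ₂ ρ₃), lt_min hρ₁ (lt_min hρ₂ hρ₃), fun ρ hρ hρlt => ?_⟩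
  have E1 := H1 ρ hρ (hρlt.trans_le (min_le_left _ _))
  have E2 := H2 ρ hρ (hρlt.trans_le ((min_le_right _ _).trans (min_le_left _ _)))
  have E3 := H3 ρ hρ (hρlt.trans_le ((min_le_right _ _).trans (min_le_right _ _)))
  filter_upwards [E1, E2, E3] with N hN1 hN2 hN3
  -- finiteness of both infima at this `N`
  have hEimp : impurityPeriodicGroundStateEnergy v N (sideLength ρ (N + 1)) 0 ≠ ⊤ := hN3.ne
  have hEper : periodicGroundStateEnergy v N (sideLength ρ (N + 1)) ≠ ⊤ :=
    ne_top_of_le_ne_top hEimp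
      (periodicGroundStateEnergy_le_impurityPeriodicGroundStateEnergy v N _ 0)
  -- the free slack from zero-momentum rigidity, then the pinned slack from the hypothesis
  obtain ⟨δ₂, hδ₂, K2⟩ := hN2 _ rfl
  obtain ⟨δ₁, hδ₁, K1⟩ := hN1 _ rfl hEper hEimp δ₂ hδ₂
  refine ⟨δ₁, hδ₁, fun Φ hΦ => ?_⟩
  have hL : 0 < sideLength ρ (N + 1) := by
    unfold sideLength
    exact Real.rpow_pos_of_pos (div_pos (by exact_mod_cast Nat.succ_pos N) hρ) _
  obtain ⟨Ψ, hΨ, hover⟩ := K1 Φ hΦ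
  exact stub_projectionTransfer N _ hL ε hε Φ Ψ hover (K2 Ψ hΨ)

/-- **Registered sub-goal (one-stub reduction, PROVED):** the "∀Φ ∃Ψ" Anderson fidelity implies the
crux `CloudMomentumAtom` — `cloudMomentumAtom_of_fidelityForEach` packaged as a closed implication so that
the ledger records the alternative single-stub skeleton. [folklore] -/
theorem stub_cloudMomentumAtom_of_fidelityForEach :
    (∀ (v : ℝ → ℝ≥0∞), IsRepulsiveFiniteRange v → ∀ ε : ℝ, 0 < ε →
      ∃ ρ₀ : ℝ, 0 < ρ₀ ∧ ∀ ρ : ℝ, 0 < ρ → ρ < ρ₀ → ∀ᶠ N : ℕ in atTop,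
        ∀ L : ℝ, L = sideLength ρ (N + 1) →
          periodicGroundStateEnergy v N L ≠ ⊤ →
          impurityPeriodicGroundStateEnergy v N L 0 ≠ ⊤ →
          ∀ δ₂ : ℝ≥0∞, 0 < δ₂ → ∃ δ₁ : ℝ≥0∞, 0 < δ₁ ∧
            ∀ Φ : PeriodicTrialState N L,
              impurityPeriodicEnergy v 0 Φ ≤ impurityPeriodicGroundStateEnergy v N L 0 + δ₁ →
              ∃ Ψ : PeriodicTrialState N L,
                periodicEnergy v Ψ ≤ periodicGroundStateEnergy v N L + δ₂ ∧
                ENNReal.ofReal (1 - ε) ≤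
                  (‖∫ X in cellN N L, conj (Ψ.ψ X) * Φ.ψ X‖₊ : ℝ≥0∞) ^ 2) →
    Summit.AtomisticToContinuum.BoseEinsteinCondensation.Theses.BECProbeMassFlow.CloudMomentumAtom :=
  fun hA => cloudMomentumAtom_of_fidelityForEach hA

end Summit.AtomisticToContinuum.BoseEinsteinCondensation.Cruxes.CloudMomentumAtom.Birth

end
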